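import Literature.NumberTheory.Weil1964.LocalLerayCocycleParabolic
import HarnessLib

/-!
# The Siegel parabolic `P_ℓ` and the trivial splitting of the Leray extension over it

Topic `NumberTheory/Weil1964`; namespace `Literature.NumberTheory.Weil1964`. KERNEL mathematics only (one definition
with body + theorems; no named fact, no `axiom`, no `sorry`). Sequel of `LocalLerayCocycleParabolic.lean`.

For `B` symplectic on `V` and `ℓ` a Lagrangian, the **Siegel parabolic** `P_ℓ = {p ∈ Sp(B) | pℓ = ℓ}`
([Rangarao1993] §2.2: "`P` … the stabiliser of `V*`"; [MoeglinVignerasWaldspurger1987] Chap. 2 II.2 `P(X)`) is a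
subgroup of `Sp(B)` (`siegelParabolic B ℓ`), and by [Rangarao1993, Thm 4.1 (2)] ("`c(σ₁, σ₂) = 1` if `σ₁, σ₂ ∈ P`")
the Leray cocycle is IDENTICALLY `1` on `P_ℓ × P_ℓ`. In the tree's splitting vocabulary
(`Literature.GroupTheory.IsSplitting`, the shape in which [GelbartRogawski1991, §3.1] / [Kudla1994] consume
splittings): **the constant function `1` splits the Leray cocycle over the inclusion `P_ℓ ↪ Sp(B)`**
(`isSplitting_lerayCentralCocycle_siegelParabolic`), so `p ↦ (p, 1)` is a homomorphic section
`P_ℓ →* LerayMetaplectic` of the Leray extension over the Siegel parabolic (`siegelParabolicLift`), the first and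
simplest of the splittings used by theta correspondences.

## References

* [Rangarao1993] R. Ranga Rao, *On some explicit formulas in the theory of Weil representation*, Pacific J. Math.
  157 (1993), §2.2 and Thm 4.1 (2), p. 358.
* [MoeglinVignerasWaldspurger1987] C. Mœglin, M.-F. Vignéras, J.-L. Waldspurger, *Correspondances de Howe sur un
  corps p-adique*, LNM 1291 (1987), Chap. 2 II.2, Chap. 3 §I.3.
-/

set_option autoImplicit false

noncomputable section

open MeasureTheory
open Literature.LinearAlgebra.QuadraticForm
open Literature.RepresentationTheory.HeisenbergGroup
open Literature.GroupTheory

namespace Literature.NumberTheory.Weil1964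

section Parabolic

variable {F : Type*} [Field F] {V : Type*} [AddCommGroup V] [Module F V]

/-- `(g h)ℓ = g(hℓ)` (plumbing). [folklore] -/
private theorem map_mul_eq₃ (ℓ : Submodule F V) (g h : V ≃ₗ[F] V) :
    ℓ.map ((g * h : V ≃ₗ[F] V) : V →ₗ[F] V) = (ℓ.map (h : V →ₗ[F] V)).map (g : V →ₗ[F] V) := by
  rw [LinearEquiv.coe_toLinearMap_mul, Module.End.mul_eq_comp, Submodule.map_comp]

/-- **the Siegel parabolic `P_ℓ = {p ∈ Sp(B) | pℓ = ℓ}`**, the stabiliser of the subspace `ℓ` in the isometry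
group of `B` ("`P` … the stabiliser of `V*`"). [cite: Rangarao1993, §2.2] -/
def siegelParabolic (B : LinearMap.BilinForm F V) (ℓ : Submodule F V) :
    Subgroup (Heisenberg.PseudoSymplectic.isometries B) where
  carrier := {p | ℓ.map ((p : V ≃ₗ[F] V) : V →ₗ[F] V) = ℓ}
  one_mem' := by
    change ℓ.map (((1 : Heisenberg.PseudoSymplectic.isometries B) : V ≃ₗ[F] V) : V →ₗ[F] V) = ℓ
    rw [Subgroup.coe_one, LinearEquiv.coe_toLinearMap_one, Submodule.map_id]
  mul_mem' {p q} hp hq := by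
    change ℓ.map (((p * q : Heisenberg.PseudoSymplectic.isometries B) : V ≃ₗ[F] V) : V →ₗ[F] V) = ℓ
    rw [Subgroup.coe_mul, map_mul_eq₃]
    rw [Set.mem_setOf_eq] at hp hq
    rw [hq, hp]
  inv_mem' {p} hp := by
    change ℓ.map (((p⁻¹ : Heisenberg.PseudoSymplectic.isometries B) : V ≃ₗ[F] V) : V →ₗ[F] V) = ℓ
    rw [Set.mem_setOf_eq] at hp
    rw [Subgroup.coe_inv]
    conv_lhs => rw [← hp]
    rw [← map_mul_eq₃, inv_mul_cancel, LinearEquiv.coe_toLinearMap_one, Submodule.map_id]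

/-- membership: `p ∈ P_ℓ ↔ pℓ = ℓ`. [cite: Rangarao1993, §2.2] -/
@[simp] theorem mem_siegelParabolic {B : LinearMap.BilinForm F V} {ℓ : Submodule F V}
    {p : Heisenberg.PseudoSymplectic.isometries B} :
    p ∈ siegelParabolic B ℓ ↔ ℓ.map ((p : V ≃ₗ[F] V) : V →ₗ[F] V) = ℓ := Iff.rfl

end Parabolic

section Splitting

variable {F : Type*} [Field F] [ValuativeRel F] [TopologicalSpace F] [IsNonarchimedeanLocalField F]
variable [MeasurableSpace F] [BorelSpace F] (μ : Measure F) [μ.IsAddHaarMeasure] {ψ : AddChar F Circle}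
  [Invertible (2 : F)]
variable {V : Type*} [AddCommGroup V] [Module F V] [FiniteDimensional F V]

/-- **the Leray cocycle is `1` on `P_ℓ × P_ℓ`** (bundled form). [cite: Rangarao1993, Thm 4.1 (2), p. 358] -/
theorem lerayCentralCocycle_siegelParabolic (hψ : ψ.IsContinuousNontrivial) {B : LinearMap.BilinForm F V}
    (hB : LinearMap.IsAlt B) (hN : B.Nondegenerate) {ℓ : Submodule F V} (hℓ : B.orthogonal ℓ = ℓ)
    (p₁ p₂ : siegelParabolic B ℓ) :
    lerayCentralCocycle μ hψ hB hN hℓ p₁ p₂ = 1 := by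
  ext
  rw [lerayCentralCocycle_apply, Units.val_one]
  exact lerayCocycle_eq_one_of_map_eq μ hψ B (isotropic_of_orthogonal_eq_self hℓ) p₁.2

/-- **the constant function `1` splits the Leray cocycle over the Siegel parabolic** `P_ℓ ↪ Sp(B)` (tree
`IsSplitting`). [cite: Rangarao1993, Thm 4.1 (2), p. 358] -/
theorem isSplitting_lerayCentralCocycle_siegelParabolic (hψ : ψ.IsContinuousNontrivial)
    {B : LinearMap.BilinForm F V} (hB : LinearMap.IsAlt B) (hN : B.Nondegenerate) {ℓ : Submodule F V}
    (hℓ : B.orthogonal ℓ = ℓ) :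
    TwistedProduct.IsSplitting (lerayCentralCocycle μ hψ hB hN hℓ) (siegelParabolic B ℓ).subtype (fun _ => 1) := by
  rw [TwistedProduct.isSplitting_one_iff]
  intro p₁ p₂
  exact lerayCentralCocycle_siegelParabolic μ hψ hB hN hℓ p₁ p₂

/-- **the homomorphic section `P_ℓ →* LerayMetaplectic`, `p ↦ (p, 1)`**, of the Leray extension over the Siegel
parabolic. [cite: Rangarao1993, Thm 4.1 (2), p. 358] -/
def siegelParabolicLift (hψ : ψ.IsContinuousNontrivial) {B : LinearMap.BilinForm F V} (hB : LinearMap.IsAlt B)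
    (hN : B.Nondegenerate) {ℓ : Submodule F V} (hℓ : B.orthogonal ℓ = ℓ) :
    siegelParabolic B ℓ →* LerayMetaplectic μ hψ hB hN hℓ :=
  (isSplitting_lerayCentralCocycle_siegelParabolic μ hψ hB hN hℓ).lift

/-- formula `p ↦ (p, 1)`. [cite: Rangarao1993, Thm 4.1 (2), p. 358] -/
theorem siegelParabolicLift_apply (hψ : ψ.IsContinuousNontrivial) {B : LinearMap.BilinForm F V}
    (hB : LinearMap.IsAlt B) (hN : B.Nondegenerate) {ℓ : Submodule F V} (hℓ : B.orthogonal ℓ = ℓ)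
    (p : siegelParabolic B ℓ) :
    siegelParabolicLift μ hψ hB hN hℓ p = ⟨(p : Heisenberg.PseudoSymplectic.isometries B), 1⟩ := rfl

/-- the section covers the inclusion: `fst ∘ lift = P_ℓ ↪ Sp(B)`. [cite: Rangarao1993, Thm 4.1 (2), p. 358] -/
theorem fst_comp_siegelParabolicLift (hψ : ψ.IsContinuousNontrivial) {B : LinearMap.BilinForm F V}
    (hB : LinearMap.IsAlt B) (hN : B.Nondegenerate) {ℓ : Submodule F V} (hℓ : B.orthogonal ℓ = ℓ) :
    (TwistedProduct.fst _).comp (siegelParabolicLift μ hψ hB hN hℓ) = (siegelParabolic B ℓ).subtype := rfl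

/-- the section is `TwistedProduct.sec` on `P_ℓ`: `sec` restricted to the Siegel parabolic is multiplicative.
[cite: Rangarao1993, Thm 4.1 (2), p. 358] -/
theorem sec_mul_sec_of_mem_siegelParabolic (hψ : ψ.IsContinuousNontrivial) {B : LinearMap.BilinForm F V}
    (hB : LinearMap.IsAlt B) (hN : B.Nondegenerate) {ℓ : Submodule F V} (hℓ : B.orthogonal ℓ = ℓ)
    (p₁ p₂ : siegelParabolic B ℓ) :
    TwistedProduct.sec (lerayCentralCocycle μ hψ hB hN hℓ) (p₁ : Heisenberg.PseudoSymplectic.isometries B) *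
        TwistedProduct.sec (lerayCentralCocycle μ hψ hB hN hℓ) (p₂ : Heisenberg.PseudoSymplectic.isometries B) =
      TwistedProduct.sec (lerayCentralCocycle μ hψ hB hN hℓ)
        ((p₁ : Heisenberg.PseudoSymplectic.isometries B) * p₂) := by
  rw [TwistedProduct.sec_mul_sec, ← Subgroup.coe_mul, lerayCentralCocycle_siegelParabolic μ hψ hB hN hℓ p₁ p₂,
    map_one, one_mul]

end Splitting

end Literature.NumberTheory.Weil1964
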